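import Literature.RingTheory.HilbertSamuel.TangentConeChangeOfGenerators
import HarnessLib

/-!
# Lifts of the directrix linear forms to `𝔪`, and the condition «`ξ ∈ ℙ(Dir(𝒪))`» read through a local
# homomorphism — independence of the minimal system of generators (CJS 2020, Def. 2.18 / Def. 2.26 / Def. 6.34 (i))

Topic: `Literature/RingTheory/HilbertSamuel`. For a noetherian local ring `A` (residue field `k`, a minimal system
of generators `x_1, …, x_e` of `𝔪`, tangent cone ideal `J_x ⊆ k[X_1, …, X_e]`, `TangentConeIdeal.lean`) the directrix
`Dir(A) ⊆ C(A) ⊆ T(A)` (CJS Def. 2.18) is cut out by the directrix space `𝒯(J_x) ⊆ k·X_1 ⊕ ⋯ ⊕ k·X_e` of linear forms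
(`Literature.RingTheory.MvPolynomial.directrixSpace`, CJS Lemma 2.7). For a local homomorphism `φ : A → B` (think
`φ = π^♯_ξ : 𝒪_{X,x} → 𝒪_{X₁,ξ}` for the blow-up `π` of `X` in `x`), the condition

  «for every `L ∈ 𝒯(J_x)` and every lift `ℓ = Σ cᵢ xᵢ ∈ 𝔪` of `L` (`c̄ᵢ =` the coefficients of `L`),
   `φ(ℓ) ∈ (𝔪 B) · 𝔪_B`»                                                              (`ProjDirLiftsInto φ x`)

says that the degree-one forms of the directrix vanish at `ξ ∈ ℙ(C_x(X)) = π⁻¹(x)`, i.e. `ξ ∈ ℙ(Dir_x(X))` — this is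
how the tree types CJS Def. 6.34 (i) «`C_1 = ℙ(Dir_x(X))`» (`CossartJannsenSaito2020.IsOnProjDirectrix`, which is
`ProjDirLiftsInto (π.stalkMap ξ) (minGenerators 𝒪_{X,x})`). We PROVE that the condition does not depend on the choices:

* `map_lift_mem_iff_of_lifts` / `projDirLiftsInto_iff_exists` — it does not depend on the LIFT (two lifts of the same
  linear form differ by an element of `𝔪²`, and `φ(𝔪²) ⊆ (𝔪B)² ⊆ (𝔪B)·𝔪_B`);
* **`projDirLiftsInto_iff_of_minimal`** — it does not depend on the MINIMAL SYSTEM OF GENERATORS: for two minimal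
  systems `x`, `x'` with transition matrices `x = a x'`, `x' = b x` one has `J_{x'} = σ_ā(J_x)`
  (`tangentConeIdeal_eq_map_linSubst`), `𝒯(σ_ā J) = σ_ā 𝒯(J)` (`directrixSpace_map_algEquiv`, CJS Lemma 2.7), and a
  lift of `L` w.r.t. `x` IS a lift of `σ_ā L` w.r.t. `x'` (`Σⱼ cⱼ xⱼ = Σₗ (Σⱼ cⱼ a_{jl}) x'_l`);
* (companion `ProjDirectrixLiftsTransport.lean`: `coe_directrixSpace_map_of_bijective` — `𝒯(I · k'[X]) = κ(𝒯(I))` for a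
  field isomorphism `κ`; `projDirLiftsInto_ringEquiv_iff` — transport along isomorphisms `α : A ≅ A'`, `β : B ≅ B'`.)

Hence «`ξ ∈ ℙ(Dir_x(X))`» is a property of the local homomorphism `𝒪_{X,x} → 𝒪_{X₁,ξ}` alone (used in
`CossartJannsenSaito2020/BlowupTowerLocalizeDir.lean` to read `ℙ(Dir)` on localised towers, CJS p. 107). NOT here: the
identification of `ℙ(Dir_x(X))` with `Proj` of `k[X]/𝒯 k[X]` as a scheme.

## References

* V. Cossart, U. Jannsen, S. Saito, *Desingularization: Invariants and Strategy*, LNM 2270 (2020), Lemma 2.7,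
  Def. 2.18, Def. 2.26, Def. 6.34 (i). [CossartJannsenSaito2020]
-/

noncomputable section

open IsLocalRing MvPolynomial Module
open Literature.AlgebraicGeometry.Resolution Literature.RingTheory.MvPolynomial

namespace Literature.RingTheory.HilbertSamuel

universe u v w

/-! ## Linear forms: coefficients and linear substitutions -/

section LinearForms

variable {k : Type v} [Field k] {e : ℕ}

/-- The `X_i`-coefficient of the linear form `Σ v_j X_j` is `v_i`. [folklore] -/
private theorem coeff_single_linForm (v : Fin e → k) (i : Fin e) :
    MvPolynomial.coeff (Finsupp.single i 1) (linForm v) = v i := by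
  classical
  rw [linForm_apply, MvPolynomial.coeff_sum]
  simp_rw [MvPolynomial.coeff_smul, MvPolynomial.coeff_X, smul_eq_mul]
  rw [Finset.sum_eq_single i]
  · simp
  · intro j _ hj
    rw [if_neg, mul_zero]
    exact fun h => hj (Finsupp.single_left_injective one_ne_zero h)
  · exact fun h => absurd (Finset.mem_univ i) h

/-- A form of degree `1` is the linear form of its `X_i`-coefficients. [folklore] -/
private theorem eq_linForm_coeff {L : MvPolynomial (Fin e) k} (hL : L ∈ homogeneousSubmodule (Fin e) k 1) :
    L = linForm fun i => MvPolynomial.coeff (Finsupp.single i 1) L := by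
  have hL' : L ∈ LinearMap.range (linForm (K := k) (n := e)) := by rwa [range_linForm]
  obtain ⟨v, rfl⟩ := hL'
  congr 1
  funext i
  rw [coeff_single_linForm]

/-- **`σ_a(Σ_j v_j X_j) = Σ_l (Σ_j v_j a_{jl}) X_l`**: a linear substitution acts on linear forms through the matrix.
[folklore] -/
private theorem linSubst_linForm (a : Matrix (Fin e) (Fin e) k) (v : Fin e → k) :
    linSubst k a (linForm v) = linForm fun l => ∑ j, v j * a j l := by
  rw [linForm_apply, linForm_apply, map_sum]
  have h1 : ∀ j, linSubst k a (v j • (X j : MvPolynomial (Fin e) k)) = ∑ l, (v j * a j l) • X l := by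
    intro j
    rw [map_smul, linSubst_X, Finset.smul_sum]
    refine Finset.sum_congr rfl fun l _ => ?_
    rw [smul_eq_C_mul, smul_eq_C_mul, ← mul_assoc, ← map_mul]
  have h2 : ∀ l, (∑ j, v j * a j l) • (X l : MvPolynomial (Fin e) k) = ∑ j, (v j * a j l) • X l :=
    fun l => Finset.sum_smul
  simp_rw [h1, h2]
  exact Finset.sum_comm

end LinearForms

/-! ## Lifts of directrix forms and the condition `ProjDirLiftsInto` -/

section Lifts

variable {A : Type u} [CommRing A] [IsLocalRing A] {B : Type w} [CommRing B] [IsLocalRing B]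
  (φ : A →+* B) {e : ℕ}

/-- **«Every lift to `𝔪` of every directrix linear form goes to `(𝔪B)·𝔪_B` under `φ`»** — the condition
`ξ ∈ ℙ(Dir_x(X))` of CJS Def. 6.34 (i) read through `φ = 𝒪_{X,x} → 𝒪_{X₁,ξ}` with respect to generators `x` of `𝔪`:
for all `L ∈ 𝒯(J_x)` and all `c` with `c̄_i = coeff_{X_i} L`, `φ(Σ c_i x_i) ∈ (𝔪_A B) · 𝔪_B`.
[cite: CossartJannsenSaito2020, Def. 6.34 (i), Def. 2.18] -/
def ProjDirLiftsInto (x : Fin e → A) (hx : Ideal.span (Set.range x) = maximalIdeal A) : Prop :=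
  ∀ L ∈ directrixSpace (tangentConeIdeal x hx), ∀ c : Fin e → A,
    (∀ i, residue A (c i) = MvPolynomial.coeff (Finsupp.single i 1) L) →
      φ (∑ i, c i * x i) ∈ (maximalIdeal A).map φ * maximalIdeal B

variable {φ} {x : Fin e → A} (hx : Ideal.span (Set.range x) = maximalIdeal A)

include hx in
/-- Two lifts of the same linear form differ by an element of `𝔪²`. [folklore] -/
private theorem sum_mul_sub_sum_mul_mem_sq {L : MvPolynomial (Fin e) (ResidueField A)} {c c' : Fin e → A}
    (hc : ∀ i, residue A (c i) = MvPolynomial.coeff (Finsupp.single i 1) L)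
    (hc' : ∀ i, residue A (c' i) = MvPolynomial.coeff (Finsupp.single i 1) L) :
    ∑ i, c i * x i - ∑ i, c' i * x i ∈ maximalIdeal A ^ 2 := by
  rw [← Finset.sum_sub_distrib, pow_two]
  refine Ideal.sum_mem _ fun i _ => ?_
  rw [← sub_mul]
  refine Ideal.mul_mem_mul ?_ ?_
  · rw [← residue_eq_zero_iff, map_sub, hc i, hc' i, sub_self]
  · rw [← hx]
    exact Ideal.subset_span ⟨i, rfl⟩

/-- `φ(𝔪_A²) ⊆ (𝔪_A B)·𝔪_B` when `φ(𝔪_A) ⊆ 𝔪_B`. [folklore] -/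
private theorem map_sq_le_map_mul_maximalIdeal (hφ : (maximalIdeal A).map φ ≤ maximalIdeal B) :
    (maximalIdeal A ^ 2).map φ ≤ (maximalIdeal A).map φ * maximalIdeal B := by
  rw [Ideal.map_pow, pow_two]
  exact Ideal.mul_mono_right hφ

include hx in
/-- **Lift invariance**: whether `φ` sends a lift of `L` into `(𝔪B)·𝔪_B` does not depend on the lift (for `φ` with
`φ(𝔪_A) ⊆ 𝔪_B`). [cite: CossartJannsenSaito2020, Def. 6.34 (i)] -/
theorem map_lift_mem_iff_of_lifts (hφ : (maximalIdeal A).map φ ≤ maximalIdeal B)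
    {L : MvPolynomial (Fin e) (ResidueField A)} {c c' : Fin e → A}
    (hc : ∀ i, residue A (c i) = MvPolynomial.coeff (Finsupp.single i 1) L)
    (hc' : ∀ i, residue A (c' i) = MvPolynomial.coeff (Finsupp.single i 1) L) :
    φ (∑ i, c i * x i) ∈ (maximalIdeal A).map φ * maximalIdeal B ↔
      φ (∑ i, c' i * x i) ∈ (maximalIdeal A).map φ * maximalIdeal B := by
  have hdiff : φ (∑ i, c i * x i) - φ (∑ i, c' i * x i) ∈ (maximalIdeal A).map φ * maximalIdeal B := by
    rw [← map_sub]
    exact map_sq_le_map_mul_maximalIdeal hφ (Ideal.mem_map_of_mem φ (sum_mul_sub_sum_mul_mem_sq hx hc hc'))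
  constructor
  · intro h
    have := sub_mem h hdiff
    rwa [sub_sub_cancel] at this
  · intro h
    have := add_mem hdiff h
    rwa [sub_add_cancel] at this

/-- Every linear form over the residue field has a lift of its coefficients. [folklore] -/
private theorem exists_lift_coeff (L : MvPolynomial (Fin e) (ResidueField A)) :
    ∃ c : Fin e → A, ∀ i, residue A (c i) = MvPolynomial.coeff (Finsupp.single i 1) L := by
  have h : ∀ i, ∃ a : A, residue A a = MvPolynomial.coeff (Finsupp.single i 1) L :=
    fun i => Ideal.Quotient.mk_surjective _
  choose c hc using h
  exact ⟨c, hc⟩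

include hx in
/-- `ProjDirLiftsInto` in «∃ a lift» form (for `φ` with `φ(𝔪_A) ⊆ 𝔪_B`). [cite: CossartJannsenSaito2020, Def. 6.34 (i)] -/
theorem projDirLiftsInto_iff_exists (hφ : (maximalIdeal A).map φ ≤ maximalIdeal B) :
    ProjDirLiftsInto φ x hx ↔ ∀ L ∈ directrixSpace (tangentConeIdeal x hx), ∃ c : Fin e → A,
      (∀ i, residue A (c i) = MvPolynomial.coeff (Finsupp.single i 1) L) ∧
        φ (∑ i, c i * x i) ∈ (maximalIdeal A).map φ * maximalIdeal B := by
  constructor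
  · intro h L hL
    obtain ⟨c, hc⟩ := exists_lift_coeff L
    exact ⟨c, hc, h L hL c hc⟩
  · intro h L hL c hc
    obtain ⟨c', hc', h'⟩ := h L hL
    exact (map_lift_mem_iff_of_lifts hx hφ hc hc').mpr h'

end Lifts

/-! ## Independence of the minimal system of generators -/

section Minimal

variable {A : Type u} [CommRing A] [IsLocalRing A] [IsNoetherianRing A] {B : Type w} [CommRing B]
  [IsLocalRing B] {φ : A →+* B} {e : ℕ} {x x' : Fin e → A}
  (hx : Ideal.span (Set.range x) = maximalIdeal A) (hx' : Ideal.span (Set.range x') = maximalIdeal A)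
  (he : (maximalIdeal A).spanFinrank = e)

include he in
/-- One direction of the independence: `ProjDirLiftsInto φ x → ProjDirLiftsInto φ x'` for two minimal systems of
generators (`φ(𝔪_A) ⊆ 𝔪_B`). Transition `x = a x'`, `x' = b x`: `J_{x'} = σ_ā J_x`, `𝒯(J_{x'}) = σ_ā 𝒯(J_x)`, and the
`x`-lift `Σ_j c_j x_j` of `L` is the `x'`-lift `Σ_l (Σ_j c_j a_{jl}) x'_l` of `σ_ā L`.
[cite: CossartJannsenSaito2020, Lemma 2.7, Def. 2.18] -/
theorem ProjDirLiftsInto.of_minimal (hφ : (maximalIdeal A).map φ ≤ maximalIdeal B)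
    (h : ProjDirLiftsInto φ x hx) : ProjDirLiftsInto φ x' hx' := by
  -- transition matrices and their reductions
  obtain ⟨a, ha⟩ := exists_matrix_rsop_eq x x' (by rw [hx, hx'])
  obtain ⟨b, hb⟩ := exists_matrix_rsop_eq x' x (by rw [hx, hx'])
  have hab := map_residue_transition_mul_eq_one_of_minimal hx he ha hb
  have hba := map_residue_transition_mul_eq_one_of_minimal hx' he hb ha
  set abar := a.map (residue A) with habar
  set bbar := b.map (residue A) with hbbar
  -- `J_{x'} = σ_ā(J_x)` and `𝒯(J_{x'}) = σ_ā(𝒯(J_x))`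
  have hJ : tangentConeIdeal x' hx' = (tangentConeIdeal x hx).map (linSubst (ResidueField A) abar) :=
    tangentConeIdeal_eq_map_linSubst hx hx' ha hb hba
  let θ := linSubstEquiv hab hba
  have hT : directrixSpace (tangentConeIdeal x' hx') =
      (directrixSpace (tangentConeIdeal x hx)).map θ.toLinearMap := by
    rw [hJ, ← map_linSubstEquiv hab hba]
    exact directrixSpace_map_algEquiv θ (fun f hf => isHomogeneous_linSubst abar hf)
      (fun f hf => isHomogeneous_linSubst bbar hf) _
  -- the «∃ a lift» form for `x'`
  rw [projDirLiftsInto_iff_exists hx' hφ]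
  intro L' hL'
  rw [hT, Submodule.mem_map] at hL'
  obtain ⟨L, hL, rfl⟩ := hL'
  obtain ⟨c, hc⟩ := exists_lift_coeff L
  -- the `x`-lift of `L` is an `x'`-lift of `σ_ā L`
  refine ⟨fun l => ∑ j, c j * a j l, fun l => ?_, ?_⟩
  · -- coefficients: `coeff_l (σ_ā L) = Σ_j coeff_j(L) ā_{jl}`
    have hL1 : L ∈ homogeneousSubmodule (Fin e) (ResidueField A) 1 :=
      directrixSpace_le_one (tangentConeIdeal x hx) hL
    have hθL : (θ.toLinearMap L : MvPolynomial (Fin e) (ResidueField A)) =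
        linForm fun l => ∑ j, MvPolynomial.coeff (Finsupp.single j 1) L * abar j l := by
      rw [AlgEquiv.toLinearMap_apply, linSubstEquiv_apply]
      conv_lhs => rw [eq_linForm_coeff hL1]
      rw [linSubst_linForm]
    rw [hθL, coeff_single_linForm, map_sum]
    refine Finset.sum_congr rfl fun j _ => ?_
    rw [map_mul, hc j, habar, Matrix.map_apply]
  · -- value: `Σ_l (Σ_j c_j a_{jl}) x'_l = Σ_j c_j x_j`
    have hval : ∑ l, (∑ j, c j * a j l) * x' l = ∑ j, c j * x j := by
      simp_rw [Finset.sum_mul, mul_assoc]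
      rw [Finset.sum_comm]
      refine Finset.sum_congr rfl fun j _ => ?_
      rw [← Finset.mul_sum, ← ha j]
    rw [hval]
    exact h L hL c hc

include he in
/-- **«`ξ ∈ ℙ(Dir(𝒪))`» does not depend on the minimal system of generators of `𝔪`** (for `φ(𝔪_A) ⊆ 𝔪_B`): the
directrix `Dir(A) ⊆ T(A)` is intrinsic (CJS Def. 2.18 via Lemma 2.7), and so is the set of lifts of its linear
equations. [cite: CossartJannsenSaito2020, Lemma 2.7, Def. 2.18] -/
theorem projDirLiftsInto_iff_of_minimal (hφ : (maximalIdeal A).map φ ≤ maximalIdeal B) :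
    ProjDirLiftsInto φ x hx ↔ ProjDirLiftsInto φ x' hx' :=
  ⟨ProjDirLiftsInto.of_minimal hx hx' he hφ, ProjDirLiftsInto.of_minimal hx' hx he hφ⟩

end Minimal


end Literature.RingTheory.HilbertSamuel

end
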